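import Summits.BirchSwinnertonDyer.BirchSwinnertonDyer.Theorems.ResidualThetaTransportAtTwoSignedMuSeedAtTwoPlusPrimLayerZeroLocal
import Summits.BirchSwinnertonDyer.BirchSwinnertonDyer.Theorems.ResidualThetaTransportAtTwoSignedMuSeedAtTwoPlusPrimTowerGap
import Summits.BirchSwinnertonDyer.BirchSwinnertonDyer.Theorems.ResidualThetaTransportAtTwoSignedMuSeedAtTwoPlusLayerGlue
import HarnessLib

/-!
# Line `norm-one-torus` of the crux `SignedMuSeedAtTwoPlus` (stmt-BirchSwinnertonDyer-21438; = `stub_residualSeedAtTwo` of Kμ⁺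
# stmt-BirchSwinnertonDyer-20689 BY NAME): the HIGHER RUNGS of the certificate — `R[T^{2^n}]` is the LAYER-`n` primitive residual
# plus set `R_n ⊆ H¹(ℚ_n, W[2^∞][2])`, so `PrimCertificate W κ γ (2^n)` ⟺ `#R_n < 2^{2^n}`
# (width seat bsd-wall-rtt-p4-w3 g6; `--supports stmt-BirchSwinnertonDyer-21438`; closes nothing)

HONEST FRAMING. THEOREMS ONLY (no `def`, no named fact, no `sorry`); nothing about any particular curve is asserted; BSD is not
proved by any of this. Generalises `…PrimLayerZero` (p609373, `n = 0`) to every layer of the cyclotomic `ℤ₂`-tower, matching the line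
card's rungs «`q = 2, 4` = the same test in `L_W(√2)`, `L_W(√(2+√2))`» (card §S3; kit `torus_layer1.tsv`: `q ≤ 3` on 103/133 covered
`Δ<0` cells).

For `W/ℚ` globally minimal good supersingular at `2`, a `ℤ₂`-extension `κ` with topological generator `γ`, `M = W[2^∞][2]`,
`R ⊆ H¹(ℚ_∞, M)` the primitive residual signed-plus set, `T = conj_γ − 1`, `res_n : H¹(ℚ_n, M) → H¹(ℚ_∞, M)`:
* `§1` `resOfLe_layer_injective` (`W(ℚ_∞)[2^∞] = 0`), `exists_resOfLe_layer_eq_of_conjH1_pow_eq` (Greenberg's Lemma 3.2 at layer `n`),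
  `pow_prime_pow_mem_layerSubgroup` (`σ^{2^n} ∈ Γ_{ℚ_n}`), `conjH1_pow_resOfLe_layer` (`conj_{γ^{2^n}}` fixes restricted classes),
  `kerPow_two_pow_iff_conjH1_pow` (`T^{2^n} c = 0 ⟺ conj_{γ^{2^n}} c = c` on the `2`-torsion group `H¹(ℚ_∞, M)`:
  `LayerDual.pow_two_pow_apply_eq_self_iff` + `conjH1_pow_apply`).
* `§2` **`primCertificate_two_pow_iff_layer`** — `PrimCertificate W κ γ (2^n)` (unfolded) **iff** there is a finite set `F₀ ⊆ H¹(ℚ_n, M)` of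
  fewer than `2^{2^n}` classes consisting exactly of the classes whose restriction lies in `R` (i.e. `R_n := res_n⁻¹(R)` is finite with
  `#R_n < 2^{2^n}`); the conditions away from `2` of `R_n` are conditions over `ℚ_n` (`resOfLe_mem_unramifiedOutside_layer_iff`,
  `forall_conjH1_resOfLe_mem_infKer_layer_iff`: `I_v, D_w ≤ ker κ ≤ Γ_{ℚ_n}`), the `2`-adic signed condition stays read over `ℚ_∞`
  (its descent to `ℚ_n`, `n ≥ 1`, is INJ⁺@2 at layer `n`, not in the tree).

References: [GreenbergLNM1716] §3 Lemmas 3.1–3.2 (PDF p. 86); [Fukuda1994] Thm. 1; [Washington1997] Prop. 13.2; [Kobayashi2003] Def. 1.1;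
[GreenbergVatsal2000] §2.
-/

set_option autoImplicit false
-- D-0017: single-problem summit, so `Summit.BirchSwinnertonDyer.BirchSwinnertonDyer.…` repeats a namespace BY DESIGN.
set_option linter.dupNamespace false

noncomputable section

open scoped Classical AddSubgroup

open WeierstrassCurve NumberField IsDedekindDomain Literature Literature.NumberTheory.EllipticCurves
  Literature.NumberTheory.GaloisRepresentations Literature.NumberTheory.EllipticCurves.GreenbergVatsal2000
  Literature.NumberTheory.EllipticCurves.Kobayashi2003 ZpExtension
  Literature.NumberTheory.EllipticCurves.GreenbergSelmer
  Literature.NumberTheory.EllipticCurves.Rank1Residual Literature.NumberTheory.EllipticCurves.IwasawaAlgebra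
  Summit.BirchSwinnertonDyer.Rank1Residual.Iwasawa
  Summit.BirchSwinnertonDyer.BirchSwinnertonDyer.Theorems.SignedTransportAtTwo

namespace Summit.BirchSwinnertonDyer.BirchSwinnertonDyer.Theorems.SignedMuAtTwo.NormOneTorus

universe u

/-! ## §1. Restriction from layer `n` -/

section Layer

variable (W : WeierstrassCurve ℚ) [W.IsElliptic] [W.IsGloballyMinimal]

/-- **`res_n : H¹(ℚ_n, W[2^∞][2]) → H¹(ℚ_∞, W[2^∞][2])` is injective** at good supersingular `2` (any `ℤ₂`-extension, any layer):
inflation–restriction with `W(ℚ_∞)[2^∞] = 0`. [cite: GreenbergLNM1716, §3 Lemma 3.1 (PDF p. 86)] -/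
theorem resOfLe_layer_injective (hss : GoodSS W 2) (κ : ZpExtension ℚ 2) (n : ℕ) :
    Function.Injective
      (Literature.NumberTheory.EllipticCurves.resOfLe ↥((↥(W.geomPrimaryTorsion 2))[(2 : ℤ)]) (κ.kerSubgroup_le_layerSubgroup n)) := by
  refine resOfLe_injective_of_forall_fixed_eq_zero (κ.kerSubgroup_le_layerSubgroup n) fun m hm ↦ ?_
  have hfix := fixedPoints_kerSubgroup_eq_bot_of_goodSS W hss κ
  have hmem : (m : ↥(W.geomPrimaryTorsion 2)) ∈ FixedPoints.addSubgroup κ.kerSubgroup (↥(W.geomPrimaryTorsion 2)) := by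
    rw [FixedPoints.mem_addSubgroup]
    intro h
    exact congrArg Subtype.val (hm h h.2)
  rw [hfix, AddSubgroup.mem_bot] at hmem
  exact Subtype.ext hmem

omit [W.IsElliptic] [W.IsGloballyMinimal] in
/-- **Greenberg's Lemma 3.2 at layer `n` for `W[2^∞][2]`**: a class of `H¹(ℚ_∞, W[2^∞][2])` fixed by `conj_{γ^{2^n}}` is restricted from
`H¹(ℚ_n, W[2^∞][2])`. [cite: GreenbergLNM1716, §3 Lemma 3.2 (PDF p. 86)] -/
theorem exists_resOfLe_layer_eq_of_conjH1_pow_eq (κ : ZpExtension ℚ 2) {γ : Field.absoluteGaloisGroup ℚ} (hγ : κ.IsTopGenerator γ)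
    (n : ℕ) (c : subgroupH1 κ.kerSubgroup ↥((↥(W.geomPrimaryTorsion 2))[(2 : ℤ)]))
    (hc : Literature.NumberTheory.EllipticCurves.conjH1 κ.kerSubgroup ↥((↥(W.geomPrimaryTorsion 2))[(2 : ℤ)]) (γ ^ 2 ^ n) c = c) :
    ∃ c₀ : subgroupH1 (κ.layerSubgroup n) ↥((↥(W.geomPrimaryTorsion 2))[(2 : ℤ)]),
      Literature.NumberTheory.EllipticCurves.resOfLe ↥((↥(W.geomPrimaryTorsion 2))[(2 : ℤ)]) (κ.kerSubgroup_le_layerSubgroup n) c₀ = c := by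
  have hcont : ∀ m : ↥((↥(W.geomPrimaryTorsion 2))[(2 : ℤ)]), Continuous fun g : Field.absoluteGaloisGroup ℚ ↦ g • m :=
    fun m ↦ continuous_smul_const_of_isOpen_stabilizer m (isOpen_stabilizer_torsionBy W m)
  have hprim : ∀ m : ↥((↥(W.geomPrimaryTorsion 2))[(2 : ℤ)]), ∃ k : ℕ, 2 ^ k • m = 0 :=
    fun m ↦ ⟨1, by rw [pow_one]; exact AddSubgroup.torsionBy.nsmul m⟩
  obtain ⟨c₀, hc₀⟩ := κ.mem_range_resOfLe_of_conjH1_eq hγ n hcont hprim c hc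
  exact ⟨c₀, hc₀⟩

omit [W.IsElliptic] [W.IsGloballyMinimal] in
/-- `σ^{2^n} ∈ Γ_{ℚ_n} = κ⁻¹(2^n ℤ₂)` for every `σ`. [cite: Washington1997, §13.1] -/
theorem pow_prime_pow_mem_layerSubgroup (κ : ZpExtension ℚ 2) (σ : Field.absoluteGaloisGroup ℚ) (n : ℕ) :
    σ ^ 2 ^ n ∈ κ.layerSubgroup n := by
  rw [ZpExtension.mem_layerSubgroup, map_pow, toAdd_pow, nsmul_eq_mul, Nat.cast_pow, Nat.cast_ofNat]
  exact dvd_mul_right _ _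

omit [W.IsElliptic] [W.IsGloballyMinimal] in
/-- Conjugation commutes with restriction from layer `n`: `conj_σ (res_n c₀) = res_n (conj_σ c₀)`. [cite: SerreLocalFields1979, VII.§5] -/
theorem conjH1_resOfLe_layer (κ : ZpExtension ℚ 2) (n : ℕ) (σ : Field.absoluteGaloisGroup ℚ)
    (c₀ : subgroupH1 (κ.layerSubgroup n) ↥((↥(W.geomPrimaryTorsion 2))[(2 : ℤ)])) :
    Literature.NumberTheory.EllipticCurves.conjH1 κ.kerSubgroup ↥((↥(W.geomPrimaryTorsion 2))[(2 : ℤ)]) σ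
        (Literature.NumberTheory.EllipticCurves.resOfLe ↥((↥(W.geomPrimaryTorsion 2))[(2 : ℤ)]) (κ.kerSubgroup_le_layerSubgroup n) c₀) =
      Literature.NumberTheory.EllipticCurves.resOfLe ↥((↥(W.geomPrimaryTorsion 2))[(2 : ℤ)]) (κ.kerSubgroup_le_layerSubgroup n)
        (Literature.NumberTheory.EllipticCurves.conjH1 (κ.layerSubgroup n) ↥((↥(W.geomPrimaryTorsion 2))[(2 : ℤ)]) σ c₀) := by
  have h1 := DFunLike.congr_fun
    (resOfLe_comp_conjH1_holds (M := ↥((↥(W.geomPrimaryTorsion 2))[(2 : ℤ)])) (κ.kerSubgroup_le_layerSubgroup n) σ) c₀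
  simp only [AddMonoidHom.coe_comp, Function.comp_apply] at h1
  exact h1.symm

omit [W.IsElliptic] [W.IsGloballyMinimal] in
/-- `conj_{γ^{2^n}}` (indeed `conj_τ` for every `τ ∈ Γ_{ℚ_n}`) fixes the classes restricted from layer `n`. [cite: SerreLocalFields1979, VII.§5 Prop. 3] -/
theorem conjH1_resOfLe_layer_of_mem (κ : ZpExtension ℚ 2) (n : ℕ) {τ : Field.absoluteGaloisGroup ℚ} (hτ : τ ∈ κ.layerSubgroup n)
    (c₀ : subgroupH1 (κ.layerSubgroup n) ↥((↥(W.geomPrimaryTorsion 2))[(2 : ℤ)])) :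
    Literature.NumberTheory.EllipticCurves.conjH1 κ.kerSubgroup ↥((↥(W.geomPrimaryTorsion 2))[(2 : ℤ)]) τ
        (Literature.NumberTheory.EllipticCurves.resOfLe ↥((↥(W.geomPrimaryTorsion 2))[(2 : ℤ)]) (κ.kerSubgroup_le_layerSubgroup n) c₀) =
      Literature.NumberTheory.EllipticCurves.resOfLe ↥((↥(W.geomPrimaryTorsion 2))[(2 : ℤ)]) (κ.kerSubgroup_le_layerSubgroup n) c₀ := by
  rw [conjH1_resOfLe_layer, Literature.NumberTheory.EllipticCurves.conjH1_of_mem_holds (κ.layerSubgroup n) _ hτ, AddMonoidHom.id_apply]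

omit [W.IsElliptic] [W.IsGloballyMinimal] in
/-- **`T^{2^n} c = 0 ⟺ conj_{γ^{2^n}} c = c`** on `H¹(ℚ_∞, W[2^∞][2])` (a group killed by `2`), `T = conj_γ − 1`.
[cite: Fukuda1994, Thm. 1 (proof)] -/
theorem kerPow_two_pow_iff_conjH1_pow (κ : ZpExtension ℚ 2) (γ : Field.absoluteGaloisGroup ℚ) (n : ℕ)
    (c : subgroupH1 κ.kerSubgroup ↥((↥(W.geomPrimaryTorsion 2))[(2 : ℤ)])) :
    ((@HSub.hSub (AddMonoid.End (subgroupH1 κ.kerSubgroup ↥((↥(W.geomPrimaryTorsion 2))[(2 : ℤ)])))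
          (AddMonoid.End (subgroupH1 κ.kerSubgroup ↥((↥(W.geomPrimaryTorsion 2))[(2 : ℤ)])))
          (AddMonoid.End (subgroupH1 κ.kerSubgroup ↥((↥(W.geomPrimaryTorsion 2))[(2 : ℤ)]))) instHSub
          (Literature.NumberTheory.EllipticCurves.conjH1 κ.kerSubgroup ↥((↥(W.geomPrimaryTorsion 2))[(2 : ℤ)]) γ) 1) ^
        2 ^ n) c = 0 ↔
      Literature.NumberTheory.EllipticCurves.conjH1 κ.kerSubgroup ↥((↥(W.geomPrimaryTorsion 2))[(2 : ℤ)]) (γ ^ 2 ^ n) c = c := by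
  have h2 : 2 • c = 0 :=
    nsmul_discreteH1_eq_zero_of_forall (fun m : ↥((↥(W.geomPrimaryTorsion 2))[(2 : ℤ)]) ↦ AddSubgroup.torsionBy.nsmul m) c
  have h := LayerDual.pow_two_pow_apply_eq_self_iff
    (@id (AddMonoid.End (subgroupH1 κ.kerSubgroup ↥((↥(W.geomPrimaryTorsion 2))[(2 : ℤ)])))
      (Literature.NumberTheory.EllipticCurves.conjH1 κ.kerSubgroup ↥((↥(W.geomPrimaryTorsion 2))[(2 : ℤ)]) γ)) n c h2
  rw [conjH1_pow_apply] at h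
  exact h.symm

end Layer

/-! ## §2. `PrimCertificate W κ γ (2^n)` is a count at layer `n` -/

section Rung

variable (W : WeierstrassCurve ℚ) [W.IsElliptic] [W.IsGloballyMinimal]

omit [W.IsElliptic] [W.IsGloballyMinimal] in
/-- **(a) over `ℚ_∞` ⟺ (aₙ) over `ℚ_n`** for a class restricted from layer `n` (`I_v ≤ ker κ ≤ Γ_{ℚ_n}`, odd `v`).
[cite: Washington1997, Prop. 13.2] [cite: GreenbergVatsal2000, §2 p. 17] -/
theorem resOfLe_mem_unramifiedOutside_layer_iff (κ : ZpExtension ℚ 2) (n : ℕ)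
    (c₀ : subgroupH1 (κ.layerSubgroup n) ↥((↥(W.geomPrimaryTorsion 2))[(2 : ℤ)])) :
    Literature.NumberTheory.EllipticCurves.resOfLe ↥((↥(W.geomPrimaryTorsion 2))[(2 : ℤ)]) (κ.kerSubgroup_le_layerSubgroup n) c₀ ∈
        unramifiedOutside κ.kerSubgroup ↥((↥(W.geomPrimaryTorsion 2))[(2 : ℤ)]) 2 (∅ : Set (HeightOneSpectrum (𝓞 ℚ))) ↔
      c₀ ∈ unramifiedOutside (κ.layerSubgroup n) ↥((↥(W.geomPrimaryTorsion 2))[(2 : ℤ)]) 2 (∅ : Set (HeightOneSpectrum (𝓞 ℚ))) := by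
  rw [mem_unramifiedOutside_iff, mem_unramifiedOutside_iff]
  refine forall_congr' fun v ↦ forall_congr' fun hvS ↦ forall_congr' fun hv2 ↦ forall_congr' fun σ ↦ ?_
  have hv2' : ((2 : ℕ) : 𝓞 ℚ) ∉ v.asIdeal := hv2
  rw [conjH1_resOfLe_layer W κ n σ c₀]
  exact resOfLe_mem_unramifiedKer_iff _ (κ.kerSubgroup_le_layerSubgroup n) v (inertia_le_kerSubgroup' κ v hv2') _

omit [W.IsElliptic] [W.IsGloballyMinimal] in
/-- **(b) over `ℚ_∞` ⟺ (bₙ) over `ℚ_n`** for a class restricted from layer `n` (`D_w ≤ ker κ`).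
[cite: Greenberg1989, §1 p. 98 (3)] [cite: SerreGaloisCohomology1997, I §2.4] -/
theorem forall_conjH1_resOfLe_mem_infKer_layer_iff (κ : ZpExtension ℚ 2) (n : ℕ)
    (c₀ : subgroupH1 (κ.layerSubgroup n) ↥((↥(W.geomPrimaryTorsion 2))[(2 : ℤ)])) :
    (∀ (w : InfinitePlace ℚ) (σ : Field.absoluteGaloisGroup ℚ),
        Literature.NumberTheory.EllipticCurves.conjH1 κ.kerSubgroup ↥((↥(W.geomPrimaryTorsion 2))[(2 : ℤ)]) σ
            (Literature.NumberTheory.EllipticCurves.resOfLe ↥((↥(W.geomPrimaryTorsion 2))[(2 : ℤ)])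
              (κ.kerSubgroup_le_layerSubgroup n) c₀) ∈
          GreenbergSelmer.infKer κ.kerSubgroup ↥((↥(W.geomPrimaryTorsion 2))[(2 : ℤ)]) w) ↔
      ∀ (w : InfinitePlace ℚ) (σ : Field.absoluteGaloisGroup ℚ),
        Literature.NumberTheory.EllipticCurves.conjH1 (κ.layerSubgroup n) ↥((↥(W.geomPrimaryTorsion 2))[(2 : ℤ)]) σ c₀ ∈
          GreenbergSelmer.infKer (κ.layerSubgroup n) ↥((↥(W.geomPrimaryTorsion 2))[(2 : ℤ)]) w := by
  refine forall_congr' fun w ↦ forall_congr' fun σ ↦ ?_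
  rw [conjH1_resOfLe_layer W κ n σ c₀]
  exact resOfLe_mem_infKer_iff _ (κ.kerSubgroup_le_layerSubgroup n) w (decompInf_le_kerSubgroup κ w) _

/-- **`PrimCertificate W κ γ (2^n)` ⟺ `#R_n < 2^{2^n}`.** For `W/ℚ` globally minimal good supersingular at `2`, a `ℤ₂`-extension
`κ` with topological generator `γ`: there is a finite set of fewer than `2^{2^n}` classes exhausting `R[T^{2^n}]` (the rung `q = 2^n`
of the member-free certificate of line `norm-one-torus`, its local definitions unfolded) iff there is a finite set of fewer than
`2^{2^n}` classes of `H¹(ℚ_n, W[2^∞][2])` exhausting the LAYER-`n` primitive residual plus set `R_n` = the classes (aₙ) unramified at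
every odd place over `ℚ_n`, (bₙ) locally trivial at every place of `ℚ_n` above `∞`, (c) whose restriction to `ℚ_∞` is signed-plus at
`2`. (`R[T^{2^n}] = res_n(R_n)` and `res_n` is injective.) [cite: GreenbergLNM1716, §3 Lemmas 3.1–3.2 (PDF p. 86)] [cite: Fukuda1994, Thm. 1] -/
theorem primCertificate_two_pow_iff_layer (hss : GoodSS W 2) (κ : ZpExtension ℚ 2) (γ : Field.absoluteGaloisGroup ℚ)
    (hγ : κ.IsTopGenerator γ) (n : ℕ) :
    (∃ F : Finset (subgroupH1 κ.kerSubgroup ↥((↥(W.geomPrimaryTorsion 2))[(2 : ℤ)])),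
        (∀ c, c ∈ F ↔ (c ∈
          {c : subgroupH1 κ.kerSubgroup ↥((↥(W.geomPrimaryTorsion 2))[(2 : ℤ)]) |
            c ∈ unramifiedOutside κ.kerSubgroup ↥((↥(W.geomPrimaryTorsion 2))[(2 : ℤ)]) 2
                  (∅ : Set (HeightOneSpectrum (𝓞 ℚ))) ∧
              (∀ (w : InfinitePlace ℚ) (σ : Field.absoluteGaloisGroup ℚ),
                Literature.NumberTheory.EllipticCurves.conjH1 κ.kerSubgroup ↥((↥(W.geomPrimaryTorsion 2))[(2 : ℤ)]) σ c ∈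
                  GreenbergSelmer.infKer κ.kerSubgroup ↥((↥(W.geomPrimaryTorsion 2))[(2 : ℤ)]) w) ∧
              (∀ (v : HeightOneSpectrum (𝓞 ℚ)), ((2 : ℕ) : 𝓞 ℚ) ∈ v.asIdeal → ∀ σ : Field.absoluteGaloisGroup ℚ,
                W.conjH1 2 κ.kerSubgroup σ
                    (pushH1 κ.kerSubgroup ((↥(W.geomPrimaryTorsion 2))[(2 : ℤ)]).subtype (subtype_torsionBy_smul W 2) c) ∈
                  localKummerOverOfEmb W 2 κ.kerSubgroup (closureEmb (K := ℚ) (v.adicCompletion ℚ))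
                    (⨆ n : ℕ, signedLocalPoints κ (v.adicCompletion ℚ) W 1 n))} ∧
          ((@HSub.hSub (AddMonoid.End (subgroupH1 κ.kerSubgroup ↥((↥(W.geomPrimaryTorsion 2))[(2 : ℤ)])))
              (AddMonoid.End (subgroupH1 κ.kerSubgroup ↥((↥(W.geomPrimaryTorsion 2))[(2 : ℤ)])))
              (AddMonoid.End (subgroupH1 κ.kerSubgroup ↥((↥(W.geomPrimaryTorsion 2))[(2 : ℤ)]))) instHSub
              (Literature.NumberTheory.EllipticCurves.conjH1 κ.kerSubgroup ↥((↥(W.geomPrimaryTorsion 2))[(2 : ℤ)]) γ) 1) ^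
            2 ^ n) c = 0)) ∧
        F.card < 2 ^ 2 ^ n) ↔
    (∃ F₀ : Finset (subgroupH1 (κ.layerSubgroup n) ↥((↥(W.geomPrimaryTorsion 2))[(2 : ℤ)])),
      (∀ c₀, c₀ ∈ F₀ ↔
        (c₀ ∈ unramifiedOutside (κ.layerSubgroup n) ↥((↥(W.geomPrimaryTorsion 2))[(2 : ℤ)]) 2 (∅ : Set (HeightOneSpectrum (𝓞 ℚ))) ∧
          (∀ (w : InfinitePlace ℚ) (σ : Field.absoluteGaloisGroup ℚ),
            Literature.NumberTheory.EllipticCurves.conjH1 (κ.layerSubgroup n) ↥((↥(W.geomPrimaryTorsion 2))[(2 : ℤ)]) σ c₀ ∈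
              GreenbergSelmer.infKer (κ.layerSubgroup n) ↥((↥(W.geomPrimaryTorsion 2))[(2 : ℤ)]) w) ∧
          (∀ (v : HeightOneSpectrum (𝓞 ℚ)), ((2 : ℕ) : 𝓞 ℚ) ∈ v.asIdeal → ∀ σ : Field.absoluteGaloisGroup ℚ,
            W.conjH1 2 κ.kerSubgroup σ
                (pushH1 κ.kerSubgroup ((↥(W.geomPrimaryTorsion 2))[(2 : ℤ)]).subtype (subtype_torsionBy_smul W 2)
                  (Literature.NumberTheory.EllipticCurves.resOfLe ↥((↥(W.geomPrimaryTorsion 2))[(2 : ℤ)])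
                    (κ.kerSubgroup_le_layerSubgroup n) c₀)) ∈
              localKummerOverOfEmb W 2 κ.kerSubgroup (closureEmb (K := ℚ) (v.adicCompletion ℚ))
                (⨆ n : ℕ, signedLocalPoints κ (v.adicCompletion ℚ) W 1 n)))) ∧
      F₀.card < 2 ^ 2 ^ n) := by
  -- notation
  set M : Type := ↥((↥(W.geomPrimaryTorsion 2))[(2 : ℤ)]) with hM
  set res := Literature.NumberTheory.EllipticCurves.resOfLe M (κ.kerSubgroup_le_layerSubgroup n) with hres
  set kW := pushH1 κ.kerSubgroup ((↥(W.geomPrimaryTorsion 2))[(2 : ℤ)]).subtype (subtype_torsionBy_smul W 2) with hkW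
  have hinj : Function.Injective res := resOfLe_layer_injective W hss κ n
  -- the upstairs predicate `R` and the layer-`n` predicate `Rₙ`
  set R : subgroupH1 κ.kerSubgroup M → Prop := fun c ↦
    c ∈ unramifiedOutside κ.kerSubgroup M 2 (∅ : Set (HeightOneSpectrum (𝓞 ℚ))) ∧
      (∀ (w : InfinitePlace ℚ) (σ : Field.absoluteGaloisGroup ℚ),
        Literature.NumberTheory.EllipticCurves.conjH1 κ.kerSubgroup M σ c ∈ GreenbergSelmer.infKer κ.kerSubgroup M w) ∧
      (∀ (v : HeightOneSpectrum (𝓞 ℚ)), ((2 : ℕ) : 𝓞 ℚ) ∈ v.asIdeal → ∀ σ : Field.absoluteGaloisGroup ℚ,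
        W.conjH1 2 κ.kerSubgroup σ (kW c) ∈
          localKummerOverOfEmb W 2 κ.kerSubgroup (closureEmb (K := ℚ) (v.adicCompletion ℚ))
            (⨆ n : ℕ, signedLocalPoints κ (v.adicCompletion ℚ) W 1 n)) with hR_def
  -- `Rₙ c₀ ↔ R (res c₀)`
  have hRn : ∀ c₀ : subgroupH1 (κ.layerSubgroup n) M,
      (c₀ ∈ unramifiedOutside (κ.layerSubgroup n) M 2 (∅ : Set (HeightOneSpectrum (𝓞 ℚ))) ∧
        (∀ (w : InfinitePlace ℚ) (σ : Field.absoluteGaloisGroup ℚ),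
          Literature.NumberTheory.EllipticCurves.conjH1 (κ.layerSubgroup n) M σ c₀ ∈ GreenbergSelmer.infKer (κ.layerSubgroup n) M w) ∧
        (∀ (v : HeightOneSpectrum (𝓞 ℚ)), ((2 : ℕ) : 𝓞 ℚ) ∈ v.asIdeal → ∀ σ : Field.absoluteGaloisGroup ℚ,
          W.conjH1 2 κ.kerSubgroup σ (kW (res c₀)) ∈
            localKummerOverOfEmb W 2 κ.kerSubgroup (closureEmb (K := ℚ) (v.adicCompletion ℚ))
              (⨆ n : ℕ, signedLocalPoints κ (v.adicCompletion ℚ) W 1 n))) ↔ R (res c₀) := by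
    intro c₀
    simp only [hR_def]
    rw [resOfLe_mem_unramifiedOutside_layer_iff W κ n c₀, forall_conjH1_resOfLe_mem_infKer_layer_iff W κ n c₀]
  -- `T^{2^n}` kills restricted classes
  have hTres : ∀ c₀ : subgroupH1 (κ.layerSubgroup n) M,
      ((@HSub.hSub (AddMonoid.End (subgroupH1 κ.kerSubgroup M)) (AddMonoid.End (subgroupH1 κ.kerSubgroup M))
          (AddMonoid.End (subgroupH1 κ.kerSubgroup M)) instHSub
          (Literature.NumberTheory.EllipticCurves.conjH1 κ.kerSubgroup M γ) 1) ^ 2 ^ n) (res c₀) = 0 := fun c₀ ↦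
    (kerPow_two_pow_iff_conjH1_pow W κ γ n (res c₀)).mpr
      (conjH1_resOfLe_layer_of_mem W κ n (pow_prime_pow_mem_layerSubgroup κ γ n) c₀)
  constructor
  · -- ⇒: `F₀ := res⁻¹(F)`
    rintro ⟨F, hF, hcard⟩
    refine ⟨F.preimage res (hinj.injOn), fun c₀ ↦ ?_, lt_of_le_of_lt ?_ hcard⟩
    · rw [Finset.mem_preimage, hF, hRn]
      exact ⟨fun h ↦ h.1, fun h ↦ ⟨h, hTres c₀⟩⟩
    · -- `#res⁻¹(F) ≤ #F`
      calc (F.preimage res hinj.injOn).card = ((F.preimage res hinj.injOn).image res).card :=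
            (Finset.card_image_of_injective _ hinj).symm
        _ ≤ F.card := Finset.card_le_card (Finset.image_subset_iff.mpr fun c₀ hc₀ ↦ Finset.mem_preimage.mp hc₀)
  · -- ⇐: `F := res(F₀)`
    rintro ⟨F₀, hF₀, hcard⟩
    refine ⟨F₀.image res, fun c ↦ ⟨fun hc ↦ ?_, fun hc ↦ ?_⟩, by rw [Finset.card_image_of_injective _ hinj]; exact hcard⟩
    · obtain ⟨c₀, hc₀, rfl⟩ := Finset.mem_image.mp hc
      exact ⟨(hRn c₀).mp ((hF₀ c₀).mp hc₀), hTres c₀⟩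
    · obtain ⟨hcR, hcT⟩ := hc
      obtain ⟨c₀, rfl⟩ := exists_resOfLe_layer_eq_of_conjH1_pow_eq W κ hγ n c
        ((kerPow_two_pow_iff_conjH1_pow W κ γ n c).mp hcT)
      exact Finset.mem_image.mpr ⟨c₀, (hF₀ c₀).mpr ((hRn c₀).mpr hcR), rfl⟩

end Rung

end Summit.BirchSwinnertonDyer.BirchSwinnertonDyer.Theorems.SignedMuAtTwo.NormOneTorus

end
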